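import Summits.QuantumFields.BalabanUV.T4Continuum.Support.NE7SliceLetterBalabanGauge
import Summits.QuantumFields.BalabanUV.T4Continuum.Support.NE3LandauOrbit
import Summits.QuantumFields.BalabanUV.T4Continuum.Support.NE3CovariantLineSumsTower
import Summits.QuantumFields.BalabanUV.T4Continuum.Support.NE3ExactLineSumsTower
import Summits.QuantumFields.BalabanUV.T4Continuum.Support.NE3LinearisedAverageSup
import Summits.QuantumFields.BalabanUV.T4Continuum.Spine.NE3.PairLandauB8
import HarnessLib

/-!
# NE7BalabanGaugeTransport — THE GAUGE-TRANSPORT LETTER (KL-T) OF F167∕F169 FOLLOWS FROM TWO SCALAR LETTERS AT SCALE `M`: (T1) a SMOOTH exact right inverse of the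
# nested transported block mean `bmeanIterW` (prescribed block means, sup size `C_a`, covariant Laplacian `C_a′`), (T2) the BLOCK-LANDAU CORRECTION on Bałaban's straight
# slice by a block-mean-zero gauge (`avgKernelGauges`, sup size `C_b` against the covariant divergence) — the rest is the exact kinematics of the k-fold average:
# `QbarIter(D_Wμ) = gaugeDir_c(bmeanIterW μ)`, `QbarIter X = −gaugeDir_c(framePotW X)` on the contour slice, `‖framePotW X‖ ≤ 6dM‖X‖_∞` (file 100 of the curved (APE), F170)

Cell `pub-balaban`, rung (B)+1 sub-cell t4, lineage `b2b-balaban-t4-ne7-p1` (CRUX PROVER NE7 #1 = OWNER of row NE7), generation 83; memo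
`t4/b2b-balaban-t4-ne7-p1-g83/BALABAN-GAUGE-ROAD.md` §5.  Over row NE3's `NE3LandauOrbit.QbarIter_gaugeDir`, `NE3CovariantBlockMean.framePotW_gaugeDir` ∕ `bmeanIterW_skew_periodic`,
`NE3CovariantLineSumsTower.QbarIter_add`, `NE3ExactLineSumsTower.norm_bmeanIterW_le_of_sup`, `NE3LinearisedAverageSup.norm_framePotW_le_sup` (`C_Φ = 6d`),
`NE3TangentCovariantTower.dirIter_eq_QbarIter_add_gaugeDir`, `NE3CurvedFrameKill.framePotW_skew_periodic`, and the Spine's `PairLandauB8.avgKernelGauges` BY NAME.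
WHY.  F169 put the curved (APE) on (KL-B) + (KL-T).  (KL-T) asks for ONE gauge parameter `λ` moving a contour-tangent `X` (with the END's known gauge part `σ`) onto
Bałaban's straight slice `ker QbarIter_W` AND into the gauge side condition, with `‖λ‖_∞ ≤ C_R R + C_Ξ Ξ + C_D D`.  Memo §5: `λ = σ + λ_a + λ_b` — `λ_a` carries the block
means `framePotW X − bmeanIterW σ` (this kills the frame part of `QbarIter`: the moved field is straight-tangent), `λ_b ∈ ker bmeanIterW` fixes the gauge on the slice
without leaving it.  The analytic content is scalar: (T1) the prescribed-mean extension must be SMOOTH (`‖Δ_Wλ_a‖ ≲ ‖θ′‖∕M²`, a C²-quasi-interpolant made exact on the coarse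
lattice — tents and block-constant lifts are one power too rough), (T2) the block-Landau correction's sup size (`C_b ≍ C_GM²`, the block-mean-zero covariant Poisson
problem — (H0_W) TYPE, volume-free because block-mean-zero is massive at scale `M`).  THIS file is the exact assembly; (T1), (T2) stay displayed.
WHAT ([folklore]; 0 def, 0 sorry).  §1 `covDiv_add'`, `gaugeDir_sub_pi`, **`QbarIter_gaugeDir_eq_bmean`** (`QbarIter L (j+1) W (D_Wμ) = gaugeDir_c (bmeanIterW μ)` — the
straight average of a pure gauge is the coarse pure gauge of its nested block mean), `QbarIter_eq_neg_frame_of_tangent` (`dirIter X = 0` ⟹ `QbarIter X = −gaugeDir_c(framePotW X)`);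
§2 **`transportLetter_of_scalarLetters`** (`d ≥ 1`) — (KL-T) with `C_R = (C_a + C_bC_a′)·6d·L^{j+1}`, `C_Ξ = 1 + C_a + C_bC_a′`, `C_D = C_b`.
HONEST FRAMING (page 1): kinematics∕bookkeeping; (T1) and (T2) are DISPLAYED HYPOTHESES (scalar rows at scale `M`, NOT proved here; power counting `C_a ≍ 1`, `C_a′ ≍ 1∕M²`,
`C_b ≍ M²` in memo §5); nothing of Bałaban's asserted; (APE) on curved data NOT proved; NOT ONE-STEP, NOT NE7; spine 0∕9; finite T⁴ rung (B)+1 — NOT infinite volume, NOT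
mass gap, NOT `BetaPertH`, NOT Clay.  Continuum YM on T⁴ ⇐ BetaPertH ∧ nine spine estimates (0/9 proved); BetaPertH ⇐ (D1) ∧ (D4) ∧ CAP+tail; G-an2-4 gates asym, D1 and NE2/3/4.
-/

set_option autoImplicit false

open scoped BigOperators Matrix Matrix.Norms.L2Operator
open NormedSpace Finset

namespace Summit.QuantumFields.BalabanUV.T4Continuum.NE7BalabanGaugeTransport

open Literature.MathematicalPhysics.QuantumFieldTheory.Balaban1983to89
open B7Prop1Explicit B7Prop2Explicit UnitaryModel
open T4AveragingDeficitWall (Ad IsUnitaryCfg IsSkewDir SmallField curlAt dirL1)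
open T4AveragingDeficitWallBoundary (IsPeriodicCfg periodBox)
open AveragingDeficitPeriodicCounting (IsPeriodicDir)
open AveragingDeficitMultiLevelPrep (cavgIter tower LevelSmall)
open AveragingDeficitNearIdentity (Ad_add)
open BlockAveragePushDirGauge (gaugeDir)
open NE3TangentCovariantTower (dirIter QbarIter framePotW dirIter_eq_QbarIter_add_gaugeDir)
open NE3TangentCovariantStructure (gaugeDir_add_fun)
open NE3CovariantWeitzenbock (covDiv)
open NE3CovariantBlockMean (bmeanIterW framePotW_gaugeDir bmeanIterW_skew_periodic)
open NE3FrameFreeSliceW (bmeanIterW_add)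
open NE3CurvedFrameKill (framePotW_skew_periodic)
open NE3FramePotBoundW (tower_eq_pow_mul)
open NE3LandauOrbit (QbarIter_gaugeDir)
open NE3CovariantLineSumsTower (QbarIter_add)
open NE3ExactLineSumsTower (norm_bmeanIterW_le_of_sup)
open NE3LinearisedAverageSup (curvSum norm_framePotW_le_sup)
open NE7SliceLetterBalabanGauge (gaugeDir_neg_pi)
open NE3.PairLandauB8 (avgKernelGauges)

noncomputable section

variable {d : ℕ} {n : Type*} [Fintype n] [DecidableEq n]

/-! ## §1 Kinematics of the straight average on pure gauges and on the contour slice -/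

/-- The covariant divergence is additive. [folklore] -/
theorem covDiv_add' (W : Site d → Fin d → (Matrix n n ℂ)ˣ) (A B : Site d → Fin d → Matrix n n ℂ) (y : Site d) :
    covDiv W (fun z κ => A z κ + B z κ) y = covDiv W A y + covDiv W B y := by
  simp only [NE3CovariantWeitzenbock.covDiv, Ad_add, ← Finset.sum_add_distrib]
  refine Finset.sum_congr rfl fun μ _ => by abel

/-- `gaugeDir V (Φ − Ψ) = gaugeDir V Φ − gaugeDir V Ψ` pointwise. [folklore] -/
theorem gaugeDir_sub_pi (V : Site d → Fin d → (Matrix n n ℂ)ˣ) (Φ Ψ : Site d → Matrix n n ℂ) (x : Site d) (μ : Fin d) :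
    gaugeDir V (fun y => Φ y - Ψ y) x μ = gaugeDir V Φ x μ - gaugeDir V Ψ x μ := by
  have h := gaugeDir_add_fun V Φ (fun y => -Ψ y) x μ
  simp only [← sub_eq_add_neg] at h
  rw [h, gaugeDir_neg_pi, sub_eq_add_neg]

/-- **THE STRAIGHT AVERAGE OF A PURE GAUGE IS THE COARSE PURE GAUGE OF ITS NESTED BLOCK MEAN**: in the multi-level small-field class, for a skew periodic `μ`,
`QbarIter L (j+1) W (gaugeDir W μ) = gaugeDir (cavgIter L (j+1) W) (bmeanIterW L (j+1) W μ)` (row NE3's `QbarIter_gaugeDir` + the curved (‡) `framePotW_gaugeDir`). [folklore] -/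
theorem QbarIter_gaugeDir_eq_bmean [Nonempty n] {L N : ℕ} [NeZero N] (hL : 1 ≤ L) (j : ℕ)
    {W : Site d → Fin d → (Matrix n n ℂ)ˣ} {x : ℝ} (hWu : IsUnitaryCfg W) (hWP : IsPeriodicCfg W ((tower L N (j + 1) : ℕ) : ℤ))
    (hx : 0 ≤ x) (hs : LevelSmall d L j x) (hWx : SmallField W x)
    {mu : Site d → Matrix n n ℂ} (hmu : ∀ y, mu y ∈ skewAdjoint (Matrix n n ℂ))
    (hmuP : ∀ (y : Site d) (i : Fin d), mu (y + ((tower L N (j + 1) : ℕ) : ℤ) • e i) = mu y) :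
    QbarIter L (j + 1) W (gaugeDir W mu) = fun z κ => gaugeDir (cavgIter L (j + 1) W) (bmeanIterW L (j + 1) W mu) z κ := by
  rw [QbarIter_gaugeDir hL j hWu hWP hx hs hWx hmu hmuP]
  have hfr : framePotW L (j + 1) W (gaugeDir W mu) = fun z => mu (((L : ℤ) ^ (j + 1)) • z) - bmeanIterW L (j + 1) W mu z :=
    funext fun z => framePotW_gaugeDir hL j hWu hWP hx hs hWx hmu hmuP z
  funext z κ
  rw [hfr, gaugeDir_sub_pi]
  abel

/-- **ON THE CONTOUR SLICE THE STRAIGHT AVERAGE IS MINUS THE COARSE PURE GAUGE OF THE ACCUMULATED FRAMES**: `dirIter X = 0` ⟹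
`QbarIter L (j+1) W X = −gaugeDir (cavgIter L (j+1) W) (framePotW L (j+1) W X)`. [folklore] -/
theorem QbarIter_eq_neg_frame_of_tangent [Nonempty n] {L N : ℕ} [NeZero N] (hL : 1 ≤ L) (j : ℕ)
    {W : Site d → Fin d → (Matrix n n ℂ)ˣ} {x : ℝ} (hWu : IsUnitaryCfg W) (hWP : IsPeriodicCfg W ((tower L N (j + 1) : ℕ) : ℤ))
    (hx : 0 ≤ x) (hs : LevelSmall d L j x) (hWx : SmallField W x)
    {X : Site d → Fin d → Matrix n n ℂ} (hX : IsSkewDir X) (hXP : IsPeriodicDir X ((tower L N (j + 1) : ℕ) : ℤ)) (hXT : dirIter L (j + 1) W X = 0) :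
    QbarIter L (j + 1) W X = fun z κ => -gaugeDir (cavgIter L (j + 1) W) (framePotW L (j + 1) W X) z κ := by
  have h := dirIter_eq_QbarIter_add_gaugeDir hL j hWu hWP hx hs hWx hX hXP
  rw [hXT] at h
  funext z κ
  have hz := congrFun (congrFun h z) κ
  simp only [Pi.zero_apply] at hz
  linear_combination (norm := skip) -hz
  abel

/-! ## §2 (KL-T) from (T1) + (T2) -/

/-- **THE GAUGE-TRANSPORT LETTER FROM TWO SCALAR LETTERS.**  Data: `L ≥ 2`, `N`, `j`, `P = N·L^{j+1}`, `M = L^{j+1}`; `W` unitary `P`-periodic in the class with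
`curvSum d L (j+1) x ≤ 2L∕3`; an arbitrary gauge side condition `Gauge`.  DISPLAYED: (T1) for every skew `N`-periodic coarse `θ′` with `‖θ′‖_∞ ≤ s` a skew `P`-periodic
`λ_a` with `bmeanIterW L (j+1) W λ_a = θ′`, `‖λ_a‖_∞ ≤ C_a·s`, `‖covDiv W (gaugeDir W λ_a)‖_∞ ≤ C_a′·s`; (T2) for every skew `P`-periodic STRAIGHT-tangent `X′` with
`‖covDiv W X′‖_∞ ≤ D′` a `λ_b ∈ avgKernelGauges L N (j+1) W` with `Gauge (X′ + gaugeDir W λ_b)` and `‖λ_b‖_∞ ≤ C_b·D′`.  THEN (KL-T) of F167∕F169 holds with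
`C_R = (C_a + C_bC_a′)·6d·L^{j+1}`, `C_Ξ = 1 + C_a + C_bC_a′`, `C_D = C_b`. [folklore] -/
theorem transportLetter_of_scalarLetters [Nonempty n] (hd : 1 ≤ d) {L N : ℕ} [NeZero N] (hL : 2 ≤ L) (j : ℕ)
    {W : Site d → Fin d → (Matrix n n ℂ)ˣ} {x : ℝ} (hWu : IsUnitaryCfg W) (hWP : IsPeriodicCfg W ((N * L ^ (j + 1) : ℕ) : ℤ))
    (hx : 0 ≤ x) (hs : LevelSmall d L j x) (hWx : SmallField W x) (hA : curvSum d L (j + 1) x ≤ 2 / 3 * L)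
    (Gauge : (Site d → Fin d → Matrix n n ℂ) → Prop) {Ca Ca' Cb : ℝ}
    (hT1 : ∀ θ' : Site d → Matrix n n ℂ, (∀ z, θ' z ∈ skewAdjoint (Matrix n n ℂ)) → (∀ (z : Site d) (i : Fin d), θ' (z + (N : ℤ) • e i) = θ' z) →
      ∀ s : ℝ, (∀ z, ‖θ' z‖ ≤ s) →
      ∃ la : Site d → Matrix n n ℂ, (∀ y, la y ∈ skewAdjoint (Matrix n n ℂ)) ∧
        (∀ (y : Site d) (i : Fin d), la (y + ((N * L ^ (j + 1) : ℕ) : ℤ) • e i) = la y) ∧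
        bmeanIterW L (j + 1) W la = θ' ∧ (∀ y, ‖la y‖ ≤ Ca * s) ∧ (∀ y, ‖covDiv W (gaugeDir W la) y‖ ≤ Ca' * s))
    (hT2 : ∀ X' : Site d → Fin d → Matrix n n ℂ, IsSkewDir X' → IsPeriodicDir X' ((N * L ^ (j + 1) : ℕ) : ℤ) → QbarIter L (j + 1) W X' = 0 →
      ∀ D' : ℝ, (∀ y, ‖covDiv W X' y‖ ≤ D') →
      ∃ lb ∈ avgKernelGauges (d := d) (n := n) L N (j + 1) W,
        Gauge (fun y κ => X' y κ + gaugeDir W lb y κ) ∧ ∀ y, ‖lb y‖ ≤ Cb * D') :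
    ∀ X : Site d → Fin d → Matrix n n ℂ, IsSkewDir X → IsPeriodicDir X ((N * L ^ (j + 1) : ℕ) : ℤ) → dirIter L (j + 1) W X = 0 →
      ∀ σ : Site d → Matrix n n ℂ, (∀ y, σ y ∈ skewAdjoint (Matrix n n ℂ)) → (∀ (y : Site d) (i : Fin d), σ (y + ((N * L ^ (j + 1) : ℕ) : ℤ) • e i) = σ y) →
      ∀ R : ℝ, (∀ y κ', ‖X y κ'‖ ≤ R) → ∀ Ξ : ℝ, (∀ y, ‖σ y‖ ≤ Ξ) →
      ∀ D : ℝ, (∀ y, ‖covDiv W (fun z κ => X z κ + gaugeDir W σ z κ) y‖ ≤ D) →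
      ∃ lam : Site d → Matrix n n ℂ, (∀ y, lam y ∈ skewAdjoint (Matrix n n ℂ)) ∧
        (∀ (y : Site d) (i : Fin d), lam (y + ((N * L ^ (j + 1) : ℕ) : ℤ) • e i) = lam y) ∧
        QbarIter L (j + 1) W (fun y κ => X y κ + gaugeDir W lam y κ) = 0 ∧ Gauge (fun y κ => X y κ + gaugeDir W lam y κ) ∧
        ∀ y, ‖lam y‖ ≤ ((Ca + Cb * Ca') * (6 * (d : ℝ) * (L : ℝ) ^ (j + 1))) * R + (1 + Ca + Cb * Ca') * Ξ + Cb * D := by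
  intro X hXs hXP hXT σ hσs hσP R hR Ξ hσΞ D hD
  have hL1 : 1 ≤ L := by omega
  have htow : (tower L N (j + 1) : ℕ) = N * L ^ (j + 1) := by rw [tower_eq_pow_mul, Nat.mul_comm]
  have hWP' : IsPeriodicCfg W ((tower L N (j + 1) : ℕ) : ℤ) := by rw [htow]; exact hWP
  have hXP' : IsPeriodicDir X ((tower L N (j + 1) : ℕ) : ℤ) := by rw [htow]; exact hXP
  have hσP' : ∀ (y : Site d) (i : Fin d), σ (y + ((tower L N (j + 1) : ℕ) : ℤ) • e i) = σ y := by rw [htow]; exact hσP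
  have hR0 : 0 ≤ R := (norm_nonneg _).trans (hR 0 ⟨0, by omega⟩)
  -- the accumulated frames `θ` of `X` and the block means `θσ` of `σ`
  obtain ⟨hθs, hθP⟩ := framePotW_skew_periodic hL1 j hWu hWP' hx hs hWx hXs hXP'
  obtain ⟨hθσs, hθσP⟩ := bmeanIterW_skew_periodic hL1 j hWu hWP' hx hs hWx hσs hσP'
  set θ : Site d → Matrix n n ℂ := framePotW L (j + 1) W X with hθdef
  set θσ : Site d → Matrix n n ℂ := bmeanIterW L (j + 1) W σ with hθσdef
  have hθb : ∀ z, ‖θ z‖ ≤ 6 * (d : ℝ) * (L : ℝ) ^ (j + 1) * R := fun z => norm_framePotW_le_sup hL j hWu hx hs hWx hR0 hR hA z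
  have hθσb : ∀ z, ‖θσ z‖ ≤ Ξ := fun z => norm_bmeanIterW_le_of_sup hL1 j hWu hx hs hWx hσΞ z
  -- (T1) on `θ′ = θ − θσ`
  set s : ℝ := 6 * (d : ℝ) * (L : ℝ) ^ (j + 1) * R + Ξ with hsdef
  obtain ⟨la, hlas, hlaP, hlam, hlab, hlaL⟩ := hT1 (fun z => θ z - θσ z)
    (fun z => (skewAdjoint (Matrix n n ℂ)).sub_mem (hθs z) (hθσs z)) (fun z i => by simp only [hθP z i, hθσP z i]) s
    (fun z => (norm_sub_le _ _).trans (by rw [hsdef]; exact add_le_add (hθb z) (hθσb z)))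
  have hlaP' : ∀ (y : Site d) (i : Fin d), la (y + ((tower L N (j + 1) : ℕ) : ℤ) • e i) = la y := by rw [htow]; exact hlaP
  -- the field moved onto the straight slice: `X′ = X + gaugeDir W (σ + λ_a)`
  set μ₁ : Site d → Matrix n n ℂ := fun y => σ y + la y with hμ₁def
  have hμ₁s : ∀ y, μ₁ y ∈ skewAdjoint (Matrix n n ℂ) := fun y => (skewAdjoint (Matrix n n ℂ)).add_mem (hσs y) (hlas y)
  have hμ₁P : ∀ (y : Site d) (i : Fin d), μ₁ (y + ((N * L ^ (j + 1) : ℕ) : ℤ) • e i) = μ₁ y := fun y i => by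
    simp only [hμ₁def, hσP y i, hlaP y i]
  have hμ₁P' : ∀ (y : Site d) (i : Fin d), μ₁ (y + ((tower L N (j + 1) : ℕ) : ℤ) • e i) = μ₁ y := by rw [htow]; exact hμ₁P
  set X' : Site d → Fin d → Matrix n n ℂ := fun y κ => X y κ + gaugeDir W μ₁ y κ with hX'def
  have hX's : IsSkewDir X' := NE7SliceLetterBalabanGauge.isSkewDir_add hXs (NE7ExactCurrent.isSkewDir_gaugeDir hWu hμ₁s)
  have hX'P : IsPeriodicDir X' ((N * L ^ (j + 1) : ℕ) : ℤ) :=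
    NE7SliceLetterBalabanGauge.isPeriodicDir_add' hXP (BlockAveragePushDirGauge.isPeriodicDir_gaugeDir hWP hμ₁P)
  have hbμ₁ : bmeanIterW L (j + 1) W μ₁ = θ := by
    have h1 : μ₁ = σ + la := by funext y; simp [hμ₁def]
    rw [h1, bmeanIterW_add, hlam]
    funext z
    simp only [Pi.add_apply, hθσdef]
    abel
  have hX'Q : QbarIter L (j + 1) W X' = 0 := by
    rw [hX'def, QbarIter_add hL1 j hWu hx hs hWx X (gaugeDir W μ₁), QbarIter_eq_neg_frame_of_tangent hL1 j hWu hWP' hx hs hWx hXs hXP' hXT,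
      QbarIter_gaugeDir_eq_bmean hL1 j hWu hWP' hx hs hWx hμ₁s hμ₁P', hbμ₁]
    funext z κ
    simp only [Pi.zero_apply]
    exact neg_add_cancel _
  -- its covariant divergence
  have hX'div : ∀ y, ‖covDiv W X' y‖ ≤ D + Ca' * s := by
    intro y
    have hsplit : X' = fun z κ => (fun z' κ' => X z' κ' + gaugeDir W σ z' κ') z κ + gaugeDir W la z κ := by
      funext z κ; simp only [hX'def, hμ₁def, gaugeDir_add_fun]; abel
    rw [hsplit, covDiv_add']
    exact (norm_add_le _ _).trans (add_le_add (hD y) (hlaL y))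
  -- (T2) on `X′`
  obtain ⟨lb, hlb, hG, hlbb⟩ := hT2 X' hX's hX'P hX'Q (D + Ca' * s) hX'div
  obtain ⟨hlbs, hlbP, hlbm⟩ := hlb
  have hlbP' : ∀ (y : Site d) (i : Fin d), lb (y + ((tower L N (j + 1) : ℕ) : ℤ) • e i) = lb y := by rw [htow]; exact hlbP
  -- the total gauge parameter
  refine ⟨fun y => μ₁ y + lb y, fun y => (skewAdjoint (Matrix n n ℂ)).add_mem (hμ₁s y) (hlbs y),
    fun y i => by simp only [hμ₁P y i, hlbP y i], ?_, ?_, ?_⟩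
  · -- straight-tangency
    have hsplit : (fun y κ => X y κ + gaugeDir W (fun y' => μ₁ y' + lb y') y κ) = fun y κ => X' y κ + gaugeDir W lb y κ := by
      funext y κ; simp only [hX'def, gaugeDir_add_fun]; abel
    rw [hsplit, QbarIter_add hL1 j hWu hx hs hWx X' (gaugeDir W lb), hX'Q, QbarIter_gaugeDir_eq_bmean hL1 j hWu hWP' hx hs hWx hlbs hlbP', hlbm]
    funext z κ
    simp [BlockAveragePushDirGauge.gaugeDir, AveragingDeficitNearIdentity.Ad_zero]
  · -- the gauge side condition
    have hsplit : (fun y κ => X y κ + gaugeDir W (fun y' => μ₁ y' + lb y') y κ) = fun y κ => X' y κ + gaugeDir W lb y κ := by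
      funext y κ; simp only [hX'def, gaugeDir_add_fun]; abel
    rw [hsplit]; exact hG
  · -- the size
    intro y
    calc ‖μ₁ y + lb y‖ ≤ ‖σ y‖ + ‖la y‖ + ‖lb y‖ := (norm_add_le _ _).trans (by gcongr; exact norm_add_le _ _)
      _ ≤ Ξ + Ca * s + Cb * (D + Ca' * s) := add_le_add (add_le_add (hσΞ y) (hlab y)) (hlbb y)
      _ = ((Ca + Cb * Ca') * (6 * (d : ℝ) * (L : ℝ) ^ (j + 1))) * R + (1 + Ca + Cb * Ca') * Ξ + Cb * D := by rw [hsdef]; ring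

end

end Summit.QuantumFields.BalabanUV.T4Continuum.NE7BalabanGaugeTransport
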